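import Summits.QuantumFields.YangMills.Theorems.SqueezedSkewnessMirrorDescentPairTorus
import Summits.QuantumFields.YangMills.Theorems.SqueezedSkewnessMirrorDescentSeam
import HarnessLib

/-!
# Route `SqueezedSkewness`, LINE φ = μ rev 7 «IR-anchored FH pair» (crux `BalabanLadder.NT`, stmt-QuantumFields-19353):
# σ-general torus bookkeeping for the mirror ASCENT

Fleet lead `ym-spine-19353-p1` g26 (`--supports stmt-QuantumFields-19353`).  The g23 packages `MirrorDescentPairTorus.floor_transfer_of_pair`,
`…ceiling_transfer_of_pair` and `MirrorDescentSeam.exists_sum_abs_sub_translate_le` carry the descent's geometry as constants (supports in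
`closedBall 0 3`, translations of norm `≤ 2`).  The ascent to an anchor height `s ≥ 1` puts the bumps at heights up to `s + 1`, so the same
lemmas are re-derived here with the ball radius `σ` and the translation size `W` as parameters (proofs verbatim; the underlying
`modulus_bound_of_pair` / `ceiling_bound_of_pair` / `sum_abs_lattice_le_sup_div` / `latticeRiemannBound` are already general):

* `ceiling_transfer_of_pair_sigma` — `Q2(θf, f) ≤ (M(2σ+3)⁴/α⁴)²·B`;
* `floor_transfer_of_pair_sigma` — `|Q2(θu, u) − Q2(θv, v)| ≤ B·2((4⁴K₁‖e‖/α⁴)(M(2σ+3)⁴/α⁴))` for `u = v(· + e)`, `‖e‖ ≤ 1`;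
* `exists_sum_abs_sub_translate_le_of_norm_le` — seam ℓ¹-envelope `K/α³` of every translate `v(· − w)`, `‖w‖ ≤ W`;
* `ceiling_arith_sigma`, `modulus_arith_mul` — the constant arithmetic (eight powers of the spacing cancel);
* `closedBall_subset_closedBall_zero_of_le`, `norm_smul_single_zero` — elementary geometry of the time axis.

Finite-torus bookkeeping only; `PairCollar6` is NOT proved; no NT statement, crux, rung or mass gap follows. [folklore]
-/

set_option autoImplicit false

noncomputable section

open scoped SchwartzMap
open MeasureTheory Filter Topology
open Literature.MathematicalPhysics.QuantumFieldTheory Literature.MathematicalPhysics.QuantumLattice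
open Literature.Probability.LatticeModels
open Summit.QuantumFields.YangMills.Cruxes.OSLegsFromFemtoAndGap.DlrCollarTransfer
open Summit.QuantumFields.YangMills.Cruxes.NT.Reference
  (sum_abs_lattice_le_sup_div tsupport_thetaTest_subset_closedBall_zero)
open Summit.QuantumFields.YangMills.Theorems.MirrorDescentModulus
open Summit.QuantumFields.YangMills.Theorems.MirrorDescentPairTorus (modulus_bound_of_pair ceiling_bound_of_pair)
open Summit.QuantumFields.YangMills.Theorems.ThermalDescentCornerCov (posZ)
open Summit.QuantumFields.YangMills.Theorems.ThermalDescentTorusDictionary (zOf)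

namespace Summit.QuantumFields.YangMills.Theorems.MirrorAscentPrep

/-! ## §1 Elementary geometry of the time axis -/

/-- `‖c • e₀‖ = |c|`. [folklore] -/
theorem norm_smul_single_zero (c : ℝ) : ‖c • EuclideanSpace.single (0 : Fin 4) (1 : ℝ)‖ = |c| := by
  rw [norm_smul, PiLp.norm_single, norm_one, mul_one, Real.norm_eq_abs]

/-- A closed ball around `c` of radius `ρ` lies in the closed ball of radius `σ` around the origin once `‖c‖ + ρ ≤ σ`. [folklore] -/
theorem closedBall_subset_closedBall_zero_of_le {c : EuclideanSpace ℝ (Fin 4)} {ρ σ : ℝ} (h : ‖c‖ + ρ ≤ σ) :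
    Metric.closedBall c ρ ⊆ Metric.closedBall (0 : EuclideanSpace ℝ (Fin 4)) σ := by
  intro y hy
  rw [Metric.mem_closedBall, dist_eq_norm] at hy
  rw [mem_closedBall_zero_iff]
  calc ‖y‖ = ‖(y - c) + c‖ := by rw [sub_add_cancel]
    _ ≤ ‖y - c‖ + ‖c‖ := norm_add_le _ _
    _ ≤ σ := by linarith

/-! ## §2 Constant arithmetic -/

/-- **Ceiling arithmetic** (σ-general): the eight powers of the spacing cancel. [folklore] -/
theorem ceiling_arith_sigma {k C c₁ α K₀ : ℝ} (hc₁ : 0 < c₁) (hα : 0 < α) (hK₀ : 0 ≤ K₀)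
    (hk : k ≤ 256 * C ^ 2 * α ^ 8 / c₁ ^ 8) :
    (K₀ / α ^ 4) * (K₀ / α ^ 4) * k ≤ 256 * C ^ 2 * K₀ ^ 2 / c₁ ^ 8 := by
  calc (K₀ / α ^ 4) * (K₀ / α ^ 4) * k ≤ (K₀ / α ^ 4) * (K₀ / α ^ 4) * (256 * C ^ 2 * α ^ 8 / c₁ ^ 8) :=
        mul_le_mul_of_nonneg_left hk (by positivity)
    _ = 256 * C ^ 2 * K₀ ^ 2 / c₁ ^ 8 := by field_simp

/-- **Modulus arithmetic** (σ-general, shift `t ≤ m·α`): the eight powers of the spacing cancel and one power of the shift survives.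
[folklore] -/
theorem modulus_arith_mul {k C c₁ α K₁ K₀ t m : ℝ} (hc₁ : 0 < c₁) (hα : 0 < α) (hK₁ : 0 ≤ K₁) (hK₀ : 0 ≤ K₀)
    (hk : k ≤ 256 * C ^ 2 * α ^ 8 / c₁ ^ 8) (ht0 : 0 ≤ t) (ht : t ≤ m * α) :
    k * (2 * ((4 ^ 4 * K₁ * t / α ^ 4) * (K₀ / α ^ 4))) ≤
      (256 * C ^ 2 / c₁ ^ 8 * (2 * (4 ^ 4 * K₁ * K₀)) * m) * α := by
  have hA : 0 ≤ 2 * ((4 ^ 4 * K₁ * t / α ^ 4) * (K₀ / α ^ 4)) := by positivity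
  calc k * (2 * ((4 ^ 4 * K₁ * t / α ^ 4) * (K₀ / α ^ 4)))
      ≤ (256 * C ^ 2 * α ^ 8 / c₁ ^ 8) * (2 * ((4 ^ 4 * K₁ * t / α ^ 4) * (K₀ / α ^ 4))) :=
        mul_le_mul_of_nonneg_right hk hA
    _ = (256 * C ^ 2 / c₁ ^ 8 * (2 * (4 ^ 4 * K₁ * K₀))) * t := by
        field_simp
    _ ≤ (256 * C ^ 2 / c₁ ^ 8 * (2 * (4 ^ 4 * K₁ * K₀))) * (m * α) :=
        mul_le_mul_of_nonneg_left ht (by positivity)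
    _ = (256 * C ^ 2 / c₁ ^ 8 * (2 * (4 ^ 4 * K₁ * K₀)) * m) * α := by ring

/-! ## §3 Torus-side ceiling and floor transfer with the ball radius as a parameter -/

section Torus

variable (G : Type) [Group G] [TopologicalSpace G] [IsTopologicalGroup G] [CompactSpace G]
  [MeasurableSpace G] [BorelSpace G] (r : LatticeRep G)

/-- **Ceiling at one coupling from a pair bound, ball radius `σ`**: `Q2(θf, f) ≤ (M(2σ+3)⁴/α⁴)²·B`. [folklore] -/
theorem ceiling_transfer_of_pair_sigma (β : ℝ) (L : ℕ) {B : ℝ} {R : ℕ}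
    (HB : ∀ x y : Fin 4 → ℤ, (2 * (R : ℤ) + 4) ≤ |((((x 0 - y 0 : ℤ) : ZMod (2 * L + 1))).valMinAbs : ℤ)| →
      |torusE G r β L (fun U => dens G r x U * dens G r y U) - torusE G r β L (dens G r x) * torusE G r β L (dens G r y)| ≤ B)
    (hB0 : 0 ≤ B) {α δ M σ : ℝ} (hσ : 0 ≤ σ) (hα : 0 < α) (hα1 : α ≤ 1) (hσL : 2 * σ ≤ α * L)
    (hRδ : ((R : ℝ) + 2) * α ≤ δ) (f : 𝓢(EuclideanSpace ℝ (Fin 4), ℝ))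
    (gap_f : ∀ p : EuclideanSpace ℝ (Fin 4), f p ≠ 0 → δ ≤ p 0)
    (ball_f : tsupport (f : EuclideanSpace ℝ (Fin 4) → ℝ) ⊆ Metric.closedBall 0 σ) (hM : ∀ y, |f y| ≤ M) :
    Q2 G r β L α (thetaTest 4 f) f ≤ (M * (2 * σ + 3) ^ 4 / α ^ 4) * (M * (2 * σ + 3) ^ 4 / α ^ 4) * B := by
  have hM0 : 0 ≤ M := (abs_nonneg _).trans (hM 0)
  have hMθ : ∀ y, |thetaTest 4 f y| ≤ M := fun y => by rw [thetaTest_apply]; exact hM _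
  have h := ceiling_bound_of_pair G r β L HB hα hσL hRδ (thetaTest 4 f) f (theta_gap gap_f) gap_f
    (tsupport_thetaTest_subset_closedBall_zero ball_f) ball_f
  have Sf : ∑ x ∈ box 4 L, |f (α • siteToE x)| ≤ M * (2 * σ + 3) ^ 4 / α ^ 4 :=
    sum_abs_lattice_le_sup_div hM ball_f hσ hα hα1 _
  have Sθ : ∑ x ∈ box 4 L, |thetaTest 4 f (α • siteToE x)| ≤ M * (2 * σ + 3) ^ 4 / α ^ 4 :=
    sum_abs_lattice_le_sup_div hMθ (tsupport_thetaTest_subset_closedBall_zero ball_f) hσ hα hα1 _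
  refine (le_abs_self _).trans (h.trans ?_)
  exact mul_le_mul_of_nonneg_right
    (mul_le_mul Sθ Sf (Finset.sum_nonneg fun _ _ => abs_nonneg _) (by positivity)) hB0

/-- **Floor transfer at one coupling from a pair bound, ball radius `σ`**: for `u = v(· + e)`, `‖e‖ ≤ 1`,
`|Q2(θu, u) − Q2(θv, v)| ≤ B · 2((4⁴K₁‖e‖/α⁴)(M(2σ+3)⁴/α⁴))`. [folklore] -/
theorem floor_transfer_of_pair_sigma (β : ℝ) (L : ℕ) {B : ℝ} {R : ℕ}
    (HB : ∀ x y : Fin 4 → ℤ, (2 * (R : ℤ) + 4) ≤ |((((x 0 - y 0 : ℤ) : ZMod (2 * L + 1))).valMinAbs : ℤ)| →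
      |torusE G r β L (fun U => dens G r x U * dens G r y U) - torusE G r β L (dens G r x) * torusE G r β L (dens G r y)| ≤ B)
    (hB0 : 0 ≤ B) {α δ M K₁ σ : ℝ} (hσ : 0 ≤ σ) (hα : 0 < α) (hα1 : α ≤ 1) (hσL : 2 * σ ≤ α * L)
    (hRδ : ((R : ℝ) + 2) * α ≤ δ)
    (v u : 𝓢(EuclideanSpace ℝ (Fin 4), ℝ)) (e : EuclideanSpace ℝ (Fin 4)) (he : ‖e‖ ≤ 1)
    (hu : ∀ y, u y = v (y + e))
    (gap_u : ∀ p : EuclideanSpace ℝ (Fin 4), u p ≠ 0 → δ ≤ p 0)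
    (gap_v : ∀ p : EuclideanSpace ℝ (Fin 4), v p ≠ 0 → δ ≤ p 0)
    (ball_u : tsupport (u : EuclideanSpace ℝ (Fin 4) → ℝ) ⊆ Metric.closedBall 0 σ)
    (ball_v : tsupport (v : EuclideanSpace ℝ (Fin 4) → ℝ) ⊆ Metric.closedBall 0 σ)
    (hM : ∀ y, |v y| ≤ M)
    (hK₁ : ∀ (z e' : EuclideanSpace ℝ (Fin 4)), ‖e'‖ ≤ 1 → |v (z + e') - v z| ≤ K₁ * ‖e'‖ * ((1 + ‖z‖) ^ 8)⁻¹) :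
    |Q2 G r β L α (thetaTest 4 u) u - Q2 G r β L α (thetaTest 4 v) v| ≤
      B * (2 * ((4 ^ 4 * K₁ * ‖e‖ / α ^ 4) * (M * (2 * σ + 3) ^ 4 / α ^ 4))) := by
  have hM0 : 0 ≤ M := (abs_nonneg _).trans (hM 0)
  have hMu : ∀ y, |u y| ≤ M := fun y => by rw [hu]; exact hM _
  have hMθv : ∀ y, |thetaTest 4 v y| ≤ M := fun y => by rw [thetaTest_apply]; exact hM _
  have hmod := modulus_bound_of_pair G r β L HB hα hσL hRδ (thetaTest 4 u) (thetaTest 4 v) u v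
    (theta_gap gap_u) (theta_gap gap_v) gap_u gap_v
    (tsupport_thetaTest_subset_closedBall_zero ball_u) (tsupport_thetaTest_subset_closedBall_zero ball_v) ball_u ball_v
  have Su : ∑ x ∈ box 4 L, |u (α • siteToE x)| ≤ M * (2 * σ + 3) ^ 4 / α ^ 4 :=
    sum_abs_lattice_le_sup_div hMu ball_u hσ hα hα1 _
  have Sθv : ∑ x ∈ box 4 L, |thetaTest 4 v (α • siteToE x)| ≤ M * (2 * σ + 3) ^ 4 / α ^ 4 :=
    sum_abs_lattice_le_sup_div hMθv (tsupport_thetaTest_subset_closedBall_zero ball_v) hσ hα hα1 _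
  have Duv : ∑ x ∈ box 4 L, |u (α • siteToE x) - v (α • siteToE x)| ≤ 4 ^ 4 * K₁ * ‖e‖ / α ^ 4 := by
    simp only [hu]
    exact sum_abs_sub_shift_le hK₁ L hα hα1 he
  have Dθuv : ∑ x ∈ box 4 L, |thetaTest 4 u (α • siteToE x) - thetaTest 4 v (α • siteToE x)| ≤
      4 ^ 4 * K₁ * ‖e‖ / α ^ 4 := by
    simp only [thetaTest_apply, hu]
    exact sum_abs_sub_shift_theta_le hK₁ L hα hα1 he
  have hS0 : ∀ f : EuclideanSpace ℝ (Fin 4) → ℝ, 0 ≤ ∑ x ∈ box 4 L, |f (α • siteToE x)| :=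
    fun f => Finset.sum_nonneg fun _ _ => abs_nonneg _
  have hA0 : 0 ≤ 4 ^ 4 * K₁ * ‖e‖ / α ^ 4 := (Finset.sum_nonneg fun _ _ => abs_nonneg _).trans Duv
  have hB0' : 0 ≤ M * (2 * σ + 3) ^ 4 / α ^ 4 := by positivity
  have h1 : (∑ x ∈ box 4 L, |thetaTest 4 u (α • siteToE x) - thetaTest 4 v (α • siteToE x)|) *
      (∑ y ∈ box 4 L, |u (α • siteToE y)|) ≤ (4 ^ 4 * K₁ * ‖e‖ / α ^ 4) * (M * (2 * σ + 3) ^ 4 / α ^ 4) :=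
    mul_le_mul Dθuv Su (hS0 _) hA0
  have h2 : (∑ x ∈ box 4 L, |thetaTest 4 v (α • siteToE x)|) *
      (∑ y ∈ box 4 L, |u (α • siteToE y) - v (α • siteToE y)|) ≤
        (M * (2 * σ + 3) ^ 4 / α ^ 4) * (4 ^ 4 * K₁ * ‖e‖ / α ^ 4) :=
    mul_le_mul Sθv Duv (Finset.sum_nonneg fun _ _ => abs_nonneg _) hB0'
  refine hmod.trans (mul_le_mul_of_nonneg_left ?_ hB0)
  calc (∑ x ∈ box 4 L, |thetaTest 4 u (α • siteToE x) - thetaTest 4 v (α • siteToE x)|) *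
          (∑ y ∈ box 4 L, |u (α • siteToE y)|) +
        (∑ x ∈ box 4 L, |thetaTest 4 v (α • siteToE x)|) *
          (∑ y ∈ box 4 L, |u (α • siteToE y) - v (α • siteToE y)|)
      ≤ (4 ^ 4 * K₁ * ‖e‖ / α ^ 4) * (M * (2 * σ + 3) ^ 4 / α ^ 4) +
          (M * (2 * σ + 3) ^ 4 / α ^ 4) * (4 ^ 4 * K₁ * ‖e‖ / α ^ 4) := add_le_add h1 h2
    _ = 2 * ((4 ^ 4 * K₁ * ‖e‖ / α ^ 4) * (M * (2 * σ + 3) ^ 4 / α ^ 4)) := by ring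

end Torus

/-! ## §4 The seam ℓ¹-envelope of a far translate -/

/-- **Seam ℓ¹-envelope of a translate `v(· − w)`, `‖w‖ ≤ W`**: `Σ_u |v(s u + s e₀ − w) − v(s u − w)| ≤ K/s³` for all tori and all
`0 < s ≤ 1`, with `K` depending on `v` and `W` only (the g23 lemma had `W = 2`). [folklore] -/
theorem exists_sum_abs_sub_translate_le_of_norm_le (v : SchwartzMap (EuclideanSpace ℝ (Fin 4)) ℝ) {W : ℝ} (hW : 0 ≤ W) :
    ∃ K : ℝ, 0 ≤ K ∧ ∀ (L : ℕ) (s : ℝ), 0 < s → s ≤ 1 → ∀ w : EuclideanSpace ℝ (Fin 4), ‖w‖ ≤ W →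
      ∑ u : FinTorusSite (2 * L + 1) (2 * L + 1) (2 * L + 1) (2 * L + 1),
        |v (s • posZ (2 * L + 1) u + s • EuclideanSpace.single (0 : Fin 4) (1 : ℝ) - w) - v (s • posZ (2 * L + 1) u - w)| ≤
        K / s ^ 3 := by
  obtain ⟨K, hK0, hK⟩ := Summit.QuantumFields.YangMills.Theorems.ThermalDescentSeamFromMoments.exists_abs_sub_le_decay v
  refine ⟨K * (1 + W) ^ 8 * 4 ^ 4, by positivity, fun L s hs hs1 w hw => ?_⟩
  have he : ‖s • EuclideanSpace.single (0 : Fin 4) (1 : ℝ)‖ = s := by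
    rw [norm_smul, PiLp.norm_single, norm_one, mul_one, Real.norm_of_nonneg hs.le]
  -- the Japanese bracket absorbs the translation: `(1 + ‖z − w‖)⁻⁸ ≤ (1+W)⁸ (1 + ‖z‖)⁻⁸`
  have hjap : ∀ z : EuclideanSpace ℝ (Fin 4), ((1 + ‖z - w‖) ^ 8)⁻¹ ≤ (1 + W) ^ 8 * ((1 + ‖z‖) ^ 8)⁻¹ := by
    intro z
    have h1 : 1 + ‖z‖ ≤ (1 + W) * (1 + ‖z - w‖) := by
      have : ‖z‖ ≤ ‖z - w‖ + ‖w‖ := by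
        calc ‖z‖ = ‖(z - w) + w‖ := by rw [sub_add_cancel]
          _ ≤ ‖z - w‖ + ‖w‖ := norm_add_le _ _
      nlinarith [norm_nonneg (z - w)]
    have hW1 : 0 < 1 + W := by linarith
    have hpos' : 0 < ((1 + ‖z‖) / (1 + W)) ^ 8 := by positivity
    calc ((1 + ‖z - w‖) ^ 8)⁻¹ ≤ (((1 + ‖z‖) / (1 + W)) ^ 8)⁻¹ :=
          inv_anti₀ hpos' (pow_le_pow_left₀ (by positivity) (by rw [div_le_iff₀ hW1]; linarith) 8)
      _ = (1 + W) ^ 8 * ((1 + ‖z‖) ^ 8)⁻¹ := by rw [div_pow, inv_div, div_eq_mul_inv, mul_comm]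
  have hpt : ∀ u : FinTorusSite (2 * L + 1) (2 * L + 1) (2 * L + 1) (2 * L + 1),
      |v (s • posZ (2 * L + 1) u + s • EuclideanSpace.single (0 : Fin 4) (1 : ℝ) - w) - v (s • posZ (2 * L + 1) u - w)| ≤
        K * s * (1 + W) ^ 8 * ((1 + ‖s • siteToE (zOf (2 * L + 1) u)‖) ^ (2 * 4))⁻¹ := by
    intro u
    have h := hK (s • posZ (2 * L + 1) u - w) (s • EuclideanSpace.single (0 : Fin 4) (1 : ℝ)) (by rw [he]; exact hs1)
    rw [he] at h
    rw [show s • posZ (2 * L + 1) u + s • EuclideanSpace.single (0 : Fin 4) (1 : ℝ) - w =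
      s • posZ (2 * L + 1) u - w + s • EuclideanSpace.single (0 : Fin 4) (1 : ℝ) from by abel]
    refine h.trans ?_
    have h2 := hjap (s • posZ (2 * L + 1) u)
    rw [Summit.QuantumFields.YangMills.Theorems.ThermalDescentSeamFromMoments.posZ_eq_siteToE_zOf] at h2 ⊢
    calc K * s * ((1 + ‖s • siteToE (zOf (2 * L + 1) u) - w‖) ^ 8)⁻¹
        ≤ K * s * ((1 + W) ^ 8 * ((1 + ‖s • siteToE (zOf (2 * L + 1) u)‖) ^ 8)⁻¹) :=
          mul_le_mul_of_nonneg_left h2 (by positivity)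
      _ = K * s * (1 + W) ^ 8 * ((1 + ‖s • siteToE (zOf (2 * L + 1) u)‖) ^ (2 * 4))⁻¹ := by norm_num; ring
  have hRB := Summit.QuantumFields.YangMills.Cruxes.UniversalDetectorLimitExtraction.latticeRiemannBound 4 L hs hs1
  have hs4 : 0 < s ^ 4 := by positivity
  have hsum : ∑ x ∈ Literature.Probability.LatticeModels.box 4 L, ((1 + ‖s • siteToE x‖) ^ (2 * 4))⁻¹ ≤ 4 ^ 4 / s ^ 4 := by
    rw [le_div_iff₀ hs4, mul_comm]; exact hRB
  calc ∑ u : FinTorusSite (2 * L + 1) (2 * L + 1) (2 * L + 1) (2 * L + 1),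
        |v (s • posZ (2 * L + 1) u + s • EuclideanSpace.single (0 : Fin 4) (1 : ℝ) - w) - v (s • posZ (2 * L + 1) u - w)|
      ≤ ∑ u : FinTorusSite (2 * L + 1) (2 * L + 1) (2 * L + 1) (2 * L + 1),
          K * s * (1 + W) ^ 8 * ((1 + ‖s • siteToE (zOf (2 * L + 1) u)‖) ^ (2 * 4))⁻¹ := Finset.sum_le_sum fun u _ => hpt u
    _ = K * s * (1 + W) ^ 8 * ∑ x ∈ Literature.Probability.LatticeModels.box 4 L, ((1 + ‖s • siteToE x‖) ^ (2 * 4))⁻¹ := by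
        rw [Finset.mul_sum, Summit.QuantumFields.YangMills.Theorems.ThermalDescentTorusDictionary.sum_box_eq_sum_fin]
    _ ≤ K * s * (1 + W) ^ 8 * (4 ^ 4 / s ^ 4) := mul_le_mul_of_nonneg_left hsum (by positivity)
    _ = K * (1 + W) ^ 8 * 4 ^ 4 / s ^ 3 := by field_simp

end Summit.QuantumFields.YangMills.Theorems.MirrorAscentPrep

end
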